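import Summits.QuantumFields.YangMills.Theorems.ColdStartUniversalityLatticeLangevinGreenKuboBilinear
import HarnessLib

/-!
# Route `ColdStartUniversality` (fixed-cut-off SZZ dynamics, sampler package): SAMPLING-INTERVAL CONSISTENCY OF THE ASYMPTOTIC VARIANCES —
# `h · σ_h²(G) → σ²(G)` as the sampling step `h → 0⁺` (Riemann sums of the stationary autocorrelation function)

Helper file (seat `ym-line-csu-p1`, g35; `--supports stmt-QuantumFields-24809`).  The discrete-sampling CLT (file 93c) has variance
`σ_h²(G) = ∫Ĝ² dμ + 2Σ_(j≥1) φ(jh)` and the time-average CLT (file 94c) has `σ²(G) = 2∫₀^∞ φ(t) dt`, where `φ(t) = ∫ Ĝ·κ_tĜ dμ_(β')` is the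
stationary autocorrelation function of the SU(2) SZZ dynamics (continuous, `|φ(t)| ≤ 2C e^(−ct)`).  This file proves that the two agree in the
limit of fine sampling: for every realising kernel family and every continuous `|G| ≤ 1`,
* `tendsto_mul_tsum_autocorrelation` — `h · Σ_(j≥1) φ(jh) → ∫₀^∞ φ(t) dt` as `h → 0⁺` (step functions `φ(⌈t/h⌉h)`, dominated convergence);
* ★★ `tendsto_mul_discreteGreenKubo` — `h · σ_h²(G) → σ²(G)` as `h → 0⁺`.
Reading: with `N = T/h` samples at spacing `h` from one run of length `T`, the CLT variance of the sample mean is `σ_h²/N = (hσ_h²)/T → σ²(G)/T`: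
sampling faster than the correlation time does not beat the continuous-time error bar.  THEOREMS ONLY, no definition, no sorry; [folklore].
HONEST FRAMING: fixed cut-off; `UniformColdStartMixing` (24809) is NOT restated; no crux, rung or summit statement is proved; the Yang–Mills mass
gap is NOT proved.
-/

set_option autoImplicit false

noncomputable section

namespace Summit.QuantumFields.YangMills.Theorems.ColdStartUniversality

open MeasureTheory ProbabilityTheory Filter Topology Set
open scoped NNReal ENNReal BigOperators
open Literature Literature.Probability.Process Literature.MathematicalPhysics.QuantumFieldTheory
open Literature.MathematicalPhysics.QuantumLattice (fundamentalRep fundamentalLatticeRep continuous_fundamentalRep)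

variable {L : ℕ} [NeZero L]

/-- **Riemann sums of an exponentially dominated continuous function on `(0,∞)`**: if `φ` is continuous with `|φ(t)| ≤ A e^(−ct)` for `t ≥ 0`
(`c > 0`), then `h · Σ'_j φ((j+1)h) → ∫_(0,∞) φ` as `h → 0⁺`. [folklore] -/
theorem tendsto_mul_tsum_of_exp_bound {φ : ℝ → ℝ} (hφc : Continuous φ) {A c : ℝ} (hc : 0 < c)
    (hφb : ∀ t : ℝ, 0 ≤ t → |φ t| ≤ A * Real.exp (-c * t)) :
    Tendsto (fun h : ℝ => h * ∑' j : ℕ, φ ((j + 1) * h)) (𝓝[>] (0 : ℝ)) (𝓝 (∫ t in Ioi (0 : ℝ), φ t)) := by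
  have hA : 0 ≤ A := by have := hφb 0 le_rfl; rw [mul_zero, Real.exp_zero, mul_one] at this; exact (abs_nonneg _).trans this
  -- the step functions `S_h(t) = φ(⌈t/h⌉ h)`
  set S : ℝ → ℝ → ℝ := fun h t => φ ((⌈t / h⌉ : ℤ) * h) with hS
  have hSm : ∀ h, Measurable (S h) := fun h =>
    hφc.measurable.comp ((measurable_from_top.comp (Int.measurable_ceil.comp (measurable_id.div_const h))).mul_const h)
  have hceil_ge : ∀ {h : ℝ}, 0 < h → ∀ t : ℝ, t ≤ (⌈t / h⌉ : ℤ) * h := fun {h} hh t => by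
    have := Int.le_ceil (t / h)
    calc t = t / h * h := by field_simp
      _ ≤ _ := mul_le_mul_of_nonneg_right this hh.le
  have hceil_lt : ∀ {h : ℝ}, 0 < h → ∀ t : ℝ, ((⌈t / h⌉ : ℤ) : ℝ) * h < t + h := fun {h} hh t => by
    have := Int.ceil_lt_add_one (t / h)
    calc ((⌈t / h⌉ : ℤ) : ℝ) * h < (t / h + 1) * h := mul_lt_mul_of_pos_right this hh
      _ = t + h := by field_simp
  set bound : ℝ → ℝ := fun t => A * Real.exp (-c * t) with hbound
  have hbi : IntegrableOn bound (Ioi (0 : ℝ)) := (exp_neg_integrableOn_Ioi 0 hc).const_mul A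
  have hSb : ∀ {h : ℝ}, 0 < h → ∀ t : ℝ, 0 < t → |S h t| ≤ bound t := fun {h} hh t ht => by
    simp only [hS, hbound]
    have h1 := hφb (((⌈t / h⌉ : ℤ) : ℝ) * h) (ht.le.trans (hceil_ge hh t))
    refine h1.trans (mul_le_mul_of_nonneg_left (Real.exp_le_exp.2 ?_) hA)
    have := hceil_ge hh t
    nlinarith
  -- `∫_(0,∞) S_h = h Σ' φ((j+1)h)`
  have hsum : ∀ {h : ℝ}, 0 < h → ∫ t in Ioi (0 : ℝ), S h t = h * ∑' j : ℕ, φ ((j + 1) * h) := by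
    intro h hh
    have hSi : IntegrableOn (S h) (Ioi (0 : ℝ)) := by
      refine Integrable.mono' hbi (hSm h).aestronglyMeasurable ?_
      filter_upwards [ae_restrict_mem measurableSet_Ioi] with t ht
      rw [Real.norm_eq_abs]; exact hSb hh t ht
    have hun : (⋃ j : ℕ, Ioc ((j : ℝ) * h) (((j : ℝ) + 1) * h)) = Ioi (0 : ℝ) := by
      ext t
      simp only [Set.mem_iUnion, Set.mem_Ioc, Set.mem_Ioi]
      constructor
      · rintro ⟨j, hj1, -⟩; exact lt_of_le_of_lt (by positivity) hj1
      · intro ht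
        refine ⟨(⌈t / h⌉ - 1).toNat, ?_, ?_⟩
        · have h1 : (1 : ℤ) ≤ ⌈t / h⌉ := Int.one_le_ceil_iff.2 (div_pos ht hh)
          have h2 : (((⌈t / h⌉ - 1).toNat : ℤ) : ℝ) = (⌈t / h⌉ : ℝ) - 1 := by
            rw [Int.toNat_of_nonneg (by linarith)]; push_cast; ring
          have h3 : (((⌈t / h⌉ - 1).toNat : ℕ) : ℝ) = (⌈t / h⌉ : ℝ) - 1 := by exact_mod_cast h2
          rw [h3]
          have := hceil_lt hh t
          nlinarith
        · have h1 : (1 : ℤ) ≤ ⌈t / h⌉ := Int.one_le_ceil_iff.2 (div_pos ht hh)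
          have h2 : (((⌈t / h⌉ - 1).toNat : ℤ) : ℝ) = (⌈t / h⌉ : ℝ) - 1 := by
            rw [Int.toNat_of_nonneg (by linarith)]; push_cast; ring
          have h3 : (((⌈t / h⌉ - 1).toNat : ℕ) : ℝ) = (⌈t / h⌉ : ℝ) - 1 := by exact_mod_cast h2
          rw [h3, sub_add_cancel]
          exact hceil_ge hh t
    have hdis : Pairwise (Function.onFun Disjoint fun j : ℕ => Ioc ((j : ℝ) * h) (((j : ℝ) + 1) * h)) := by
      intro i j hij
      rcases lt_or_gt_of_ne hij with hlt | hlt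
      · refine Set.disjoint_left.2 fun t hti htj => ?_
        have h1 : ((i : ℝ) + 1) * h ≤ (j : ℝ) * h := mul_le_mul_of_nonneg_right (by exact_mod_cast Nat.succ_le_of_lt hlt) hh.le
        exact absurd (lt_of_le_of_lt (hti.2.trans h1) htj.1) (lt_irrefl _)
      · refine Set.disjoint_left.2 fun t hti htj => ?_
        have h1 : ((j : ℝ) + 1) * h ≤ (i : ℝ) * h := mul_le_mul_of_nonneg_right (by exact_mod_cast Nat.succ_le_of_lt hlt) hh.le
        exact absurd (lt_of_le_of_lt (htj.2.trans h1) hti.1) (lt_irrefl _)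
    rw [← hun] at hSi ⊢
    rw [integral_iUnion (fun j => measurableSet_Ioc) hdis hSi]
    have hpiece : ∀ j : ℕ, ∫ t in Ioc ((j : ℝ) * h) (((j : ℝ) + 1) * h), S h t = h * φ ((j + 1) * h) := by
      intro j
      have hcongr : ∫ t in Ioc ((j : ℝ) * h) (((j : ℝ) + 1) * h), S h t = ∫ t in Ioc ((j : ℝ) * h) (((j : ℝ) + 1) * h), φ ((j + 1) * h) := by
        refine setIntegral_congr_fun measurableSet_Ioc fun t ht => ?_
        simp only [hS]
        have hc' : (⌈t / h⌉ : ℤ) = (j : ℤ) + 1 := by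
          rw [Int.ceil_eq_iff]
          push_cast
          constructor
          · rw [add_sub_cancel_right, lt_div_iff₀ hh]; exact ht.1
          · rw [div_le_iff₀ hh]; exact ht.2
        rw [hc']; push_cast; ring_nf
      rw [hcongr, setIntegral_const, smul_eq_mul, Real.volume_real_Ioc_of_le (by nlinarith)]
      ring
    simp_rw [hpiece]
    exact tsum_mul_left
  -- dominated convergence as `h → 0⁺`
  have hlim : Tendsto (fun h : ℝ => ∫ t in Ioi (0 : ℝ), S h t) (𝓝[>] (0 : ℝ)) (𝓝 (∫ t in Ioi (0 : ℝ), φ t)) := by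
    refine tendsto_integral_filter_of_dominated_convergence bound ?_ ?_ hbi ?_
    · exact Eventually.of_forall fun h => (hSm h).aestronglyMeasurable
    · filter_upwards [self_mem_nhdsWithin] with h hh
      filter_upwards [ae_restrict_mem measurableSet_Ioi] with t ht
      rw [Real.norm_eq_abs]; exact hSb hh t ht
    · filter_upwards [ae_restrict_mem measurableSet_Ioi] with t ht
      have hct : Tendsto (fun h : ℝ => ((⌈t / h⌉ : ℤ) : ℝ) * h) (𝓝[>] (0 : ℝ)) (𝓝 t) := by
        have hup : Tendsto (fun h : ℝ => t + h) (𝓝[>] (0 : ℝ)) (𝓝 t) := by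
          have : Tendsto (fun h : ℝ => t + h) (𝓝 (0 : ℝ)) (𝓝 (t + 0)) := tendsto_const_nhds.add tendsto_id
          rw [add_zero] at this
          exact this.mono_left nhdsWithin_le_nhds
        refine tendsto_of_tendsto_of_tendsto_of_le_of_le' tendsto_const_nhds hup ?_ ?_
        · filter_upwards [self_mem_nhdsWithin] with h hh using hceil_ge hh t
        · filter_upwards [self_mem_nhdsWithin] with h hh using (hceil_lt hh t).le
      exact (hφc.tendsto t).comp hct
  refine hlim.congr' ?_
  filter_upwards [self_mem_nhdsWithin] with h hh
  exact hsum hh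

/-- ★★ **Sampling-interval consistency of the asymptotic variances**: for every realising kernel family and every continuous `|G| ≤ 1`, with
`φ(t) = ∫ Ĝ·κ_tĜ dμ_(β')`, the discrete Green–Kubo constant `σ_h² = ∫Ĝ² dμ + 2Σ'_j φ((j+1)h)` of the `h`-skeleton (file 93c) satisfies
`h·σ_h² → 2∫₀^∞ φ = σ²(G)` (file 94c) as `h → 0⁺`. [folklore] -/
theorem tendsto_mul_discreteGreenKubo (L : ℕ) [NeZero L] (β' : ℝ)
    (κ : ℝ≥0 → Kernel (GaugeConfig 3 L (Matrix.specialUnitaryGroup (Fin 2) ℂ))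
      (GaugeConfig 3 L (Matrix.specialUnitaryGroup (Fin 2) ℂ))) [∀ t, IsMarkovKernel (κ t)]
    (hreal : ∀ (t : ℝ≥0) (x : GaugeConfig 3 L (Matrix.specialUnitaryGroup (Fin 2) ℂ))
        (Ω : Type) [MeasurableSpace Ω] (P : Measure Ω) [IsProbabilityMeasure P]
        (W : ℝ≥0 → Ω → (Edge 3 L × NoiseIdx 2 → ℝ)) (hW : IsFlatBrownian W P)
        (U : ℝ≥0 → Ω → GaugeConfig 3 L (Matrix.specialUnitaryGroup (Fin 2) ℂ)),
        (∀ ω, U 0 ω = x) →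
        (latticeLangevinDynamics (fundamentalLatticeRep 2) β').IsSolution (fundamentalRep (Fin 2))
          hW.natFiltration P W U →
        κ t x = P.map (U t))
    {G : GaugeConfig 3 L (Matrix.specialUnitaryGroup (Fin 2) ℂ) → ℝ} (hGc : Continuous G) (hG1 : ∀ z, |G z| ≤ 1) :
    Tendsto (fun h : ℝ => h * ((∫ y, (G y - ∫ z, G z ∂(wilsonMeasure (d := 3) (L := L) (fundamentalRep (Fin 2)) β')) ^ 2
        ∂(wilsonMeasure (d := 3) (L := L) (fundamentalRep (Fin 2)) β')) +
      2 * ∑' j : ℕ, ∫ y, (G y - ∫ z, G z ∂(wilsonMeasure (d := 3) (L := L) (fundamentalRep (Fin 2)) β')) *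
        (∫ z, (G z - ∫ z', G z' ∂(wilsonMeasure (d := 3) (L := L) (fundamentalRep (Fin 2)) β')) ∂(κ (((j + 1 : ℕ) : ℝ≥0) * h.toNNReal) y))
        ∂(wilsonMeasure (d := 3) (L := L) (fundamentalRep (Fin 2)) β'))) (𝓝[>] (0 : ℝ))
      (𝓝 (2 * ∫ t in Ioi (0 : ℝ), (∫ y, (G y - ∫ z, G z ∂(wilsonMeasure (d := 3) (L := L) (fundamentalRep (Fin 2)) β')) *
        (∫ z, (G z - ∫ z', G z' ∂(wilsonMeasure (d := 3) (L := L) (fundamentalRep (Fin 2)) β')) ∂(κ t.toNNReal y))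
        ∂(wilsonMeasure (d := 3) (L := L) (fundamentalRep (Fin 2)) β')))) := by
  classical
  haveI := secondCountableTopology_su2
  haveI := borelSpace_config L
  set μ : Measure (GaugeConfig 3 L (Matrix.specialUnitaryGroup (Fin 2) ℂ)) :=
    wilsonMeasure (d := 3) (L := L) (fundamentalRep (Fin 2)) β' with hμ
  haveI : IsProbabilityMeasure μ :=
    isProbabilityMeasure_wilsonMeasure (d := 3) (L := L) (fundamentalRep (Fin 2)) (continuous_fundamentalRep (Fin 2)) β'
  set m : ℝ := ∫ z, G z ∂μ with hm
  set Gh : GaugeConfig 3 L (Matrix.specialUnitaryGroup (Fin 2) ℂ) → ℝ := fun z => G z - m with hGh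
  have hGhc : Continuous Gh := hGc.sub continuous_const
  have hG : Measurable G := hGc.measurable
  have hm1 : |m| ≤ 1 := by
    have hh := norm_integral_le_of_norm_le_const (μ := μ) (f := G) (C := 1)
      (Eventually.of_forall fun z => by simpa [Real.norm_eq_abs] using hG1 z)
    simpa [Real.norm_eq_abs] using hh
  have hGhb : ∀ z, |Gh z| ≤ 2 := fun z => (abs_sub _ _).trans (by linarith [hG1 z, hm1])
  set φ : ℝ → ℝ := fun t => ∫ y, Gh y * (∫ z, Gh z ∂(κ t.toNNReal y)) ∂μ with hφ
  have hφc : Continuous φ := (integrableOn_crossCorrelation L β' κ hreal hGhc hGhb hGc hG1).1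
  -- `|φ(t)| ≤ 2C e^{-ct}`
  obtain ⟨C, c, hC, hc, hmix⟩ := abs_transition_sub_wilson_le_exp L β'
  have hGi : ∀ (ν : Measure (GaugeConfig 3 L (Matrix.specialUnitaryGroup (Fin 2) ℂ))) [IsProbabilityMeasure ν], Integrable G ν := fun ν _ =>
    (integrable_const (1 : ℝ)).mono' hG.aestronglyMeasurable (Eventually.of_forall fun z => by simpa [Real.norm_eq_abs] using hG1 z)
  have hκb : ∀ (t : ℝ≥0) y, |∫ z, Gh z ∂(κ t y)| ≤ C * Real.exp (-c * t) := fun t y => by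
    have heq : ∫ z, Gh z ∂(κ t y) = (∫ z, G z ∂(κ t y)) - m := by
      simp only [hGh]; rw [integral_sub (hGi _) (integrable_const m), integral_const, smul_eq_mul, probReal_univ, one_mul]
    rw [heq]; exact hmix κ hreal G hG hG1 t y
  have hφb : ∀ t : ℝ, 0 ≤ t → |φ t| ≤ 2 * C * Real.exp (-c * t) := fun t ht => by
    have hh := norm_integral_le_of_norm_le_const (μ := μ) (f := fun y => Gh y * (∫ z, Gh z ∂(κ t.toNNReal y))) (C := 2 * C * Real.exp (-c * t))
      (Eventually.of_forall fun y => by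
        rw [Real.norm_eq_abs, abs_mul]
        have h1 := hκb t.toNNReal y
        rw [Real.coe_toNNReal t ht] at h1
        calc |Gh y| * |∫ z, Gh z ∂(κ t.toNNReal y)| ≤ 2 * (C * Real.exp (-c * t)) := mul_le_mul (hGhb y) h1 (abs_nonneg _) (by norm_num)
          _ = 2 * C * Real.exp (-c * t) := by ring)
    simpa [Real.norm_eq_abs] using hh
  have hmain := tendsto_mul_tsum_of_exp_bound hφc hc hφb
  -- rewrite the skeleton kernel times `((j+1) : ℝ≥0) * h.toNNReal = (((j+1) h)).toNNReal` for `h > 0`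
  have hker : ∀ {h : ℝ}, 0 < h → ∀ j : ℕ, (((j + 1 : ℕ) : ℝ≥0) * h.toNNReal) = (((j : ℝ) + 1) * h).toNNReal := fun {h} hh j => by
    apply NNReal.coe_injective
    rw [NNReal.coe_mul, Real.coe_toNNReal _ hh.le, Real.coe_toNNReal _ (by positivity)]
    push_cast; ring
  have heq : ∀ {h : ℝ}, 0 < h →
      h * ((∫ y, Gh y ^ 2 ∂μ) + 2 * ∑' j : ℕ, ∫ y, Gh y * (∫ z, Gh z ∂(κ (((j + 1 : ℕ) : ℝ≥0) * h.toNNReal) y)) ∂μ) =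
        h * (∫ y, Gh y ^ 2 ∂μ) + 2 * (h * ∑' j : ℕ, φ (((j : ℝ) + 1) * h)) := by
    intro h hh
    have h1 : (fun j : ℕ => ∫ y, Gh y * (∫ z, Gh z ∂(κ (((j + 1 : ℕ) : ℝ≥0) * h.toNNReal) y)) ∂μ) = fun j : ℕ => φ (((j : ℝ) + 1) * h) := by
      funext j; simp only [hφ]; rw [hker hh j]
    rw [h1]; ring
  have hlim0 : Tendsto (fun h : ℝ => h * (∫ y, Gh y ^ 2 ∂μ) + 2 * (h * ∑' j : ℕ, φ (((j : ℝ) + 1) * h))) (𝓝[>] (0 : ℝ))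
      (𝓝 (0 * (∫ y, Gh y ^ 2 ∂μ) + 2 * ∫ t in Ioi (0 : ℝ), φ t)) :=
    ((tendsto_id.mono_left nhdsWithin_le_nhds).mul_const _).add (hmain.const_mul 2)
  rw [zero_mul, zero_add] at hlim0
  refine hlim0.congr' ?_
  filter_upwards [self_mem_nhdsWithin] with h hh
  rw [← heq hh]

end Summit.QuantumFields.YangMills.Theorems.ColdStartUniversality

end
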